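import Summits.Ventures.PercRepro.Night2BasisFloors

/-!
# night-2: the mass of the basis pairs at a target is `≤ (221/360) · (number of lossy bases inside it) / D`

For a five-point set `Q' ⊆ V` write `Q = K ∪ Q'`.  The basis pairs `(B, z)` with `insert z B = Q` are the pairs
`(Q.erase w, w)` for the points `w ∈ Q'` whose face `Q.erase w` is a thin member off which `w` lies (`faceOk`); their
losses sum to `(1 − fS Q) · Σ req ≤ (1 − fS Q) · L1 Q ≤ L1 Q − 11/18 ≤ 221/360` (`sum_loss_faces_le`: `L1 Q ≤ 7/120 + 5 · 7/30`
by `L1_le_of_fatClosures_le_one`, the coloops of `Q'` being at most its five points).  Hence the basis pairs' mass at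
a target `T` is at most `(221/360)/D` times the number of LOSSY five-point subsets of `T ∖ K` (`pi2MassH_le_lossy_count`)
— the mass side of the basis pairs' fair share reduces to counting lossy bases (paper NIGHT-2-g31 §3; the
assembly is `Night2BasisCountSum`).
-/

namespace PercRepro.Shadow

open PercRepro.ThmH PercRepro.PerFlat

variable {α : Type*} [DecidableEq α] {M : Matroid α} [M.Finite] {G : Finset α}

/-- The faces of `Q` at its points `w` that are thin members off which `w` lies. -/
noncomputable def faceOk (M : Matroid α) [M.Finite] (G Q : Finset α) (w : α) : Prop :=
  Q.erase w ∈ thinMembers M 5 G ∧ w ∈ G \ clF M (Q.erase w)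

/-- `faceOk` is decidable. -/
noncomputable instance faceOk.decidable (Q : Finset α) (w : α) : Decidable (faceOk M G Q w) := by
  unfold faceOk
  infer_instance

/-- A lossy basis: a five-point subset `Q'` of `V` one of whose faces loses. -/
noncomputable def lossyBasis (M : Matroid α) [M.Finite] (G Q' : Finset α) : Prop :=
  ∃ w ∈ Q', faceOk M G (coloops M G ∪ Q') w ∧ loss M 5 G ((coloops M G ∪ Q').erase w) w ≠ 0

/-- `lossyBasis` is decidable. -/
noncomputable instance lossyBasis.decidable (Q' : Finset α) : Decidable (lossyBasis M G Q') := by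
  unfold lossyBasis
  infer_instance

/-- A good face of `Q` is a thin covering preimage of `Q`. -/
theorem face_mem_thin_coverPreimages {Q : Finset α} {w : α} (hw : w ∈ Q) (h : faceOk M G Q w) :
    Q.erase w ∈ (coverPreimages M (Uq M (5 + 2) 5) G Q).filter (fun F => F ∉ lay0 M 5 G) := by
  obtain ⟨hthin, hwcl⟩ := h
  rw [Finset.mem_filter, mem_coverPreimages]
  refine ⟨⟨(mem_thinMembers.1 hthin).1, ?_⟩, (mem_thinMembers.1 hthin).2⟩
  unfold coverSets
  rw [Finset.mem_image]
  exact ⟨w, hwcl, Finset.insert_erase hw⟩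

/-- The requests of the good faces of `Q` sum to at most `L1 Q`. -/
theorem sum_req_faces_le_L1 (Q : Finset α) :
    ∑ w ∈ Q.filter (fun w => faceOk M G Q w), req M 5 (Q.erase w) ≤ L1 M 5 G Q := by
  unfold L1
  rw [← Finset.sum_image (f := fun F => req M 5 F) (g := fun w => Q.erase w) (s := Q.filter (fun w => faceOk M G Q w))
    (fun w hw w' hw' heq => erase_injOn Q (Finset.mem_filter.1 hw).1 (Finset.mem_filter.1 hw').1 heq)]
  apply Finset.sum_le_sum_of_subset_of_nonneg
  · intro F hF
    rw [Finset.mem_image] at hF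
    obtain ⟨w, hw, rfl⟩ := hF
    rw [Finset.mem_filter] at hw
    exact face_mem_thin_coverPreimages hw.1 hw.2
  · intro F _ _
    unfold req phiQ
    positivity

/-- **The losses of the faces of a five-point set sum to at most `221/360`** (cell `(2, 1)`, at most one fat closure):
`(1 − fS Q) · Σ req ≤ (1 − fS Q) · L1 Q ≤ L1 Q − capS Q ≤ 7/120 + 5 · 7/30 − 11/18`. -/
theorem sum_loss_faces_le (hG : G ∈ flatsQ M (5 + 1)) (hd : (gr M \ G).card = 2) (hk : kColoops M G = 1)
    (hfat : (fatClosures M 5 G 2).card ≤ 1) {Q' : Finset α} (hQ'G : Q' ⊆ G \ coloops M G) (hQ'5 : Q'.card = 5) :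
    ∑ w ∈ Q'.filter (fun w => faceOk M G (coloops M G ∪ Q') w), loss M 5 G ((coloops M G ∪ Q').erase w) w ≤
      221 / 360 := by
  have hd' : (gr M \ G).card ≤ 5 := by omega
  have hKG : coloops M G ⊆ G := fun y hy => (mem_coloops.1 hy).1
  set Q := coloops M G ∪ Q' with hQ
  have hQG : Q ⊆ G := Finset.union_subset hKG (hQ'G.trans Finset.sdiff_subset)
  have hKQ : coloops M G ⊆ Q := Finset.subset_union_left
  have hQK : Q \ coloops M G = Q' := by
    rw [hQ, Finset.union_sdiff_cancel_left]
    rw [Finset.disjoint_left]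
    intro a ha ha'
    exact (Finset.mem_sdiff.1 (hQ'G ha')).2 ha
  -- `L1 Q ≤ 7/120 + 5 · 7/30`
  have hL1 : L1 M 5 G Q ≤ 7 / 120 + 5 * (7 / 30) := by
    have h1 := L1_le_of_fatClosures_le_one hG hd hk hfat hQG hKQ
    have h2 : (coloops M (Q \ coloops M G)).card ≤ 5 := by
      rw [hQK, ← hQ'5]
      exact Finset.card_le_card (fun a ha => (mem_coloops.1 ha).1)
    have h2' : ((coloops M (Q \ coloops M G)).card : ℚ) ≤ 5 := by exact_mod_cast h2
    nlinarith
  have hcap := capS_ge_eleven_eighteenths_two_one hd hk hQG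
  -- the faces' losses factor through `1 − fS Q`
  have hfactor : ∑ w ∈ Q'.filter (fun w => faceOk M G Q w), loss M 5 G (Q.erase w) w =
      (1 - fS M 5 G Q) * ∑ w ∈ Q'.filter (fun w => faceOk M G Q w), req M 5 (Q.erase w) := by
    rw [Finset.mul_sum]
    apply Finset.sum_congr rfl
    intro w hw
    rw [Finset.mem_filter] at hw
    unfold loss
    rw [Finset.insert_erase (Finset.mem_union_right _ hw.1)]
    ring
  -- the good faces of `Q` are among its points
  have hsub : Q'.filter (fun w => faceOk M G Q w) ⊆ Q.filter (fun w => faceOk M G Q w) :=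
    Finset.filter_subset_filter _ Finset.subset_union_right
  have hreq : ∑ w ∈ Q'.filter (fun w => faceOk M G Q w), req M 5 (Q.erase w) ≤ L1 M 5 G Q := by
    refine le_trans (Finset.sum_le_sum_of_subset_of_nonneg hsub ?_) (sum_req_faces_le_L1 Q)
    intro w _ _
    unfold req phiQ
    positivity
  have hreq0 : 0 ≤ ∑ w ∈ Q'.filter (fun w => faceOk M G Q w), req M 5 (Q.erase w) :=
    Finset.sum_nonneg (fun w _ => by unfold req phiQ; positivity)
  rw [hfactor]
  unfold fS
  split_ifs with hle
  · simp only [sub_self, zero_mul]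
    norm_num
  · push Not at hle
    have hL1pos : 0 < L1 M 5 G Q := by linarith
    have h1 : 1 - capS M 5 G Q / L1 M 5 G Q = (L1 M 5 G Q - capS M 5 G Q) / L1 M 5 G Q := by
      field_simp
    rw [h1]
    have h2 : 0 ≤ L1 M 5 G Q - capS M 5 G Q := by linarith
    calc (L1 M 5 G Q - capS M 5 G Q) / L1 M 5 G Q * ∑ w ∈ Q'.filter (fun w => faceOk M G Q w), req M 5 (Q.erase w)
        ≤ (L1 M 5 G Q - capS M 5 G Q) / L1 M 5 G Q * L1 M 5 G Q := by
          apply mul_le_mul_of_nonneg_left hreq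
          exact div_nonneg h2 hL1pos.le
      _ = L1 M 5 G Q - capS M 5 G Q := by field_simp
      _ ≤ 221 / 360 := by linarith

/-- **The basis pairs' mass at `T` is at most `(221/360)/D` times the number of lossy five-point subsets of `T ∖ K`**,
`D = 2^(|G| − 6) − 1`. -/
theorem pi2MassH_le_lossy_count (hG : G ∈ flatsQ M (5 + 1)) (hd : (gr M \ G).card = 2) (hk : kColoops M G = 1)
    (hfat : (fatClosures M 5 G 2).card ≤ 1) {T : Finset α} (hTG : T ⊆ G) :
    pi2MassH M 5 G (bigP M G) T ≤
      ((((T \ coloops M G).powersetCard 5).filter (fun Q' => lossyBasis M G Q')).card : ℚ) *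
        ((221 / 360) / ((2 ^ (G.card - 6) - 1 : ℕ) : ℚ)) := by
  have hd' : (gr M \ G).card ≤ 5 := by omega
  have hGg : G ⊆ gr M := (mem_flatsQ.1 hG).1
  have hKG : coloops M G ⊆ G := fun y hy => (mem_coloops.1 hy).1
  set D : ℚ := ((2 ^ (G.card - 6) - 1 : ℕ) : ℚ) with hD
  -- the pairs below `T`, and `rhoL = loss / D`
  set PP := (((thinMembers M 5 G).filter (fun B => ¬ bigP M G B)).sigma (fun B => G \ clF M B)).filter
    (fun p => T ∈ tgtSets M 5 G p.1 p.2) with hPP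
  have hmass : pi2MassH M 5 G (bigP M G) T = ∑ p ∈ PP, rhoL M 5 G p.1 p.2 := by
    rw [hPP, Finset.sum_filter, Finset.sum_sigma]
    unfold pi2MassH
    rw [Finset.sum_filter]
  have hrho : ∀ p ∈ PP, rhoL M 5 G p.1 p.2 = loss M 5 G p.1 p.2 / D := by
    intro p hp
    rw [hPP, Finset.mem_filter, Finset.mem_sigma, Finset.mem_filter] at hp
    obtain ⟨⟨⟨hB, hnP⟩, hz⟩, -⟩ := hp
    have hB4 := card_sdiff_eq_four_of_not_bigP hG hd hk hB hnP
    unfold rhoL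
    rw [card_tgtSets hG (mem_thinMembers.1 hB).1 hz,
      card_sdiff_insert_eq_dqm1 (ρ := 5) hG hd' hB (by omega) hz, hk]
    have hcard : G.card - 1 - 5 = G.card - 6 := by omega
    rw [hcard]
  -- reindex the pairs by (basis, marked point)
  set g : (Σ _ : Finset α, α) → (Σ _ : Finset α, α) := fun p => ⟨insert p.2 p.1 \ coloops M G, p.2⟩ with hg
  have hfacts : ∀ p ∈ PP, p.2 ∉ p.1 ∧ p.2 ∉ coloops M G ∧ coloops M G ⊆ p.1 ∧ insert p.2 p.1 ⊆ T ∧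
      (p.1 \ coloops M G).card = 4 ∧ p.1 ∈ thinMembers M 5 G ∧ p.2 ∈ G \ clF M p.1 := by
    intro p hp
    rw [hPP, Finset.mem_filter, Finset.mem_sigma, Finset.mem_filter] at hp
    obtain ⟨⟨⟨hB, hnP⟩, hz⟩, hT⟩ := hp
    have hKB : coloops M G ⊆ p.1 := coloops_subset_of_mem_thinMembers hG hd' hB
    have hzB : p.2 ∉ p.1 := fun h => (Finset.mem_sdiff.1 hz).2
      (subset_clF_of_subset_gr ((subset_G_of_mem_thinMembers hB).trans hGg) h)
    exact ⟨hzB, fun h => hzB (hKB h), hKB, (mem_tgtSets.1 hT).2.1, card_sdiff_eq_four_of_not_bigP hG hd hk hB hnP,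
      hB, hz⟩
  have hinj : Set.InjOn g ↑PP := by
    intro p hp p' hp' heq
    rw [Finset.mem_coe] at hp hp'
    obtain ⟨hzB, hzK, hKB, -, -, -, -⟩ := hfacts p hp
    obtain ⟨hzB', hzK', hKB', -, -, -, -⟩ := hfacts p' hp'
    simp only [hg, Sigma.mk.injEq] at heq
    obtain ⟨h1, h2⟩ := heq
    have h2' : p.2 = p'.2 := eq_of_heq h2
    rw [Finset.insert_sdiff_of_notMem _ hzK, Finset.insert_sdiff_of_notMem _ hzK', h2'] at h1
    have h3 : p.1 \ coloops M G = p'.1 \ coloops M G := by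
      have := congrArg (fun s => s.erase p'.2) h1
      rwa [Finset.erase_insert (fun h => hzB (h2' ▸ (Finset.mem_sdiff.1 h).1)),
        Finset.erase_insert (fun h => hzB' (Finset.mem_sdiff.1 h).1)] at this
    have h4 : p.1 = p'.1 := by
      rw [← Finset.sdiff_union_of_subset hKB, ← Finset.sdiff_union_of_subset hKB', h3]
    exact Sigma.ext h4 h2
  -- the image lies in the marked lossy bases of `T ∖ K`
  set LB := (((T \ coloops M G).powersetCard 5).filter (fun Q' => lossyBasis M G Q')) with hLB
  have hloss_eq : ∀ p ∈ PP, loss M 5 G p.1 p.2 = loss M 5 G ((coloops M G ∪ (g p).1).erase (g p).2) (g p).2 := by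
    intro p hp
    obtain ⟨hzB, hzK, hKB, -, -, -, -⟩ := hfacts p hp
    simp only [hg]
    congr 1
    rw [Finset.union_sdiff_of_subset (hKB.trans (Finset.subset_insert _ _)), Finset.erase_insert hzB]
  have hmaps : ∀ p ∈ PP, loss M 5 G p.1 p.2 ≠ 0 → (g p).1 ∈ LB ∧ (g p).2 ∈ (g p).1 ∧
      faceOk M G (coloops M G ∪ (g p).1) (g p).2 := by
    intro p hp hne
    obtain ⟨hzB, hzK, hKB, hQT, hB4, hB, hz⟩ := hfacts p hp
    have hQ'eq : coloops M G ∪ (g p).1 = insert p.2 p.1 := by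
      simp only [hg]
      exact Finset.union_sdiff_of_subset (hKB.trans (Finset.subset_insert _ _))
    have hface : faceOk M G (coloops M G ∪ (g p).1) p.2 := by
      unfold faceOk
      rw [hQ'eq, Finset.erase_insert hzB]
      exact ⟨hB, hz⟩
    have hmem : p.2 ∈ (g p).1 := by
      simp only [hg]
      exact Finset.mem_sdiff.2 ⟨Finset.mem_insert_self _ _, hzK⟩
    refine ⟨?_, hmem, hface⟩
    rw [hLB, Finset.mem_filter, Finset.mem_powersetCard]
    refine ⟨⟨fun a ha => ?_, ?_⟩, ⟨p.2, hmem, hface, ?_⟩⟩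
    · simp only [hg] at ha
      rw [Finset.mem_sdiff] at ha ⊢
      exact ⟨hQT ha.1, ha.2⟩
    · simp only [hg]
      rw [Finset.insert_sdiff_of_notMem _ hzK, Finset.card_insert_of_notMem (fun h => hzB (Finset.mem_sdiff.1 h).1), hB4]
    · rw [← hloss_eq p hp]
      exact hne
  -- the sum of the losses over the pairs is at most the sum over the lossy bases of their faces' losses
  have hsum : ∑ p ∈ PP, loss M 5 G p.1 p.2 ≤
      ∑ Q' ∈ LB, ∑ w ∈ Q'.filter (fun w => faceOk M G (coloops M G ∪ Q') w),
        loss M 5 G ((coloops M G ∪ Q').erase w) w := by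
    -- drop the lossless pairs, then reindex by `g`
    have hnn : ∀ p ∈ PP, 0 ≤ loss M 5 G p.1 p.2 := by
      intro p hp
      obtain ⟨-, -, -, -, -, hB, hz⟩ := hfacts p hp
      exact loss_nonneg (le_trans (by norm_num) (capS_ge_eleven_eighteenths_two_one hd hk
        (Finset.insert_subset (Finset.mem_sdiff.1 hz).1 (subset_G_of_mem_thinMembers hB))))
    set PP' := PP.filter (fun p => loss M 5 G p.1 p.2 ≠ 0) with hPP'
    have hPP'sub : PP' ⊆ PP := Finset.filter_subset _ _
    have hdrop : ∑ p ∈ PP, loss M 5 G p.1 p.2 = ∑ p ∈ PP', loss M 5 G p.1 p.2 := by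
      rw [hPP']
      exact (Finset.sum_filter_of_ne (fun p _ h => h)).symm
    have hsig : ∑ Q' ∈ LB, ∑ w ∈ Q'.filter (fun w => faceOk M G (coloops M G ∪ Q') w),
        loss M 5 G ((coloops M G ∪ Q').erase w) w =
        ∑ q ∈ LB.sigma (fun Q' => Q'.filter (fun w => faceOk M G (coloops M G ∪ Q') w)),
          loss M 5 G ((coloops M G ∪ q.1).erase q.2) q.2 := by
      rw [Finset.sum_sigma]
    have himg : ∑ p ∈ PP', loss M 5 G p.1 p.2 =
        ∑ q ∈ PP'.image g, loss M 5 G ((coloops M G ∪ q.1).erase q.2) q.2 := by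
      rw [Finset.sum_image (fun p hp p' hp' heq => hinj (hPP'sub hp) (hPP'sub hp') heq)]
      exact Finset.sum_congr rfl (fun p hp => hloss_eq p (hPP'sub hp))
    rw [hdrop, hsig, himg]
    apply Finset.sum_le_sum_of_subset_of_nonneg
    · intro q hq
      rw [Finset.mem_image] at hq
      obtain ⟨p, hp, rfl⟩ := hq
      rw [hPP', Finset.mem_filter] at hp
      obtain ⟨h1, h2, h3⟩ := hmaps p hp.1 hp.2
      exact Finset.mem_sigma.2 ⟨h1, Finset.mem_filter.2 ⟨h2, h3⟩⟩
    · intro q hq _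
      obtain ⟨-, hq2⟩ := Finset.mem_sigma.1 hq
      have hface : faceOk M G (coloops M G ∪ q.1) q.2 := (Finset.mem_filter.1 hq2).2
      obtain ⟨hthin, hw⟩ := hface
      exact loss_nonneg (le_trans (by norm_num) (capS_ge_eleven_eighteenths_two_one hd hk
        (Finset.insert_subset (Finset.mem_sdiff.1 hw).1 (subset_G_of_mem_thinMembers hthin))))
  -- each lossy basis contributes at most `221/360`
  have hper : ∀ Q' ∈ LB, ∑ w ∈ Q'.filter (fun w => faceOk M G (coloops M G ∪ Q') w),
      loss M 5 G ((coloops M G ∪ Q').erase w) w ≤ 221 / 360 := by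
    intro Q' hQ'
    rw [hLB, Finset.mem_filter, Finset.mem_powersetCard] at hQ'
    exact sum_loss_faces_le hG hd hk hfat (hQ'.1.1.trans (Finset.sdiff_subset_sdiff hTG (Finset.Subset.refl _)))
      hQ'.1.2
  have htot : ∑ Q' ∈ LB, ∑ w ∈ Q'.filter (fun w => faceOk M G (coloops M G ∪ Q') w),
      loss M 5 G ((coloops M G ∪ Q').erase w) w ≤ LB.card • (221 / 360 : ℚ) :=
    Finset.sum_le_card_nsmul _ _ _ hper
  rw [nsmul_eq_mul] at htot
  -- assemble
  rw [hmass, Finset.sum_congr rfl hrho, ← Finset.sum_div]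
  by_cases hD0 : D = 0
  · rw [hD0, div_zero]
    positivity
  · have hDpos : 0 < D := lt_of_le_of_ne (by rw [hD]; exact Nat.cast_nonneg _) (Ne.symm hD0)
    rw [div_le_iff₀ hDpos]
    calc ∑ p ∈ PP, loss M 5 G p.1 p.2 ≤ (LB.card : ℚ) * (221 / 360) := hsum.trans htot
      _ = (LB.card : ℚ) * (221 / 360 / D) * D := by field_simp


end PercRepro.Shadow
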